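import Literature.MathematicalPhysics.QuantumFieldTheory.Balaban1983to89.Node00.Record13SClassSepCoPH
import Literature.MathematicalPhysics.QuantumFieldTheory.Balaban1983to89.Node00.Record13CarriersB8SubBP2C

/-!
# NODE 00 (YM-PLAN Track A) — THE `b8`-GENERIC S-CLASS AT THE v1.7 KEY: `IsRecordOfRecord₁₃CSepCoPHG` — def-T's `IsRecordOfRecord₁₃CSepCoPH` with the world bound to the
# C-BINDING of record over the v1.7 Stage-13 view WITH ITS `b8` BLOCK RE-BOUND TO AN ARBITRARY RUN-INDEXED PROPOSITION `b8sel P` (`Upstream.withB8`); dag-n10-d's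
# RS-currency class `IsRecordOfRecord₁₃CSepCoPHS` (`upOfRecord₅CS` = `withB8 (B8LeafRS …)`) and dag-n05-w1's repaired-currency «P₂C» binding `upOfRecord₅CSC … C₇`
# (`withB8 (B8LeafRSC … C₇ …)`) are BOTH members — same consequence family, same hosting at re-bound ∕ four-pin views

NODE 00 RECORD MODULE (width seat `pub-ymgap-dag-n05-w4` g2, 2026-08-28; OPTION (b) of width seat `pub-ymgap-dag-n05-w1` g0's LOCATED-SCLASS-CURRENCY (cell bus 2026-08-28
04:22Z): «the class generalised over the `b8` binder — both RS and RSC records are members; off-`b8` leaves identical by `withB8`»).  APPEND-ONLY: a NEW importing module;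
NOTHING in `Record13SClassSepCoPH` ∕ `Record13CarriersSepCoPH` ∕ `Record13CarriersCoPH` (dag-n10-d), `Record13CarriersB8SubBP2C` (dag-n05-w1), `B8LeafKnitRS` (dag-n05-a;
`Upstream.withB8`) or below them is edited — everything BY NAME.  The RS class STANDS (it is K1⁷ v6's registered `RecordS` text); this class is its `b8`-generic
super-class, offered to the planners for the «P₂C» edition (one `RecordG`-style rung text would cover the RS and the repaired-currency bindings alike).

WHY.  After dag-n05-d's DESIGN «P₂C» the N05 slot that every printed member of [Balaban1985RegularSpaces] serves (Prop. 7 in the repaired currency for print's tower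
map; `B8LeafOfRecordSubBP₂C` = `B8LeafRSC` at `c₇OfRecord θ`) is bound at the record by dag-n05-w1's `upOfRecord₅CSC`, NOT by `upOfRecord₅CS` (whose `b8` is the RS leaf
`B8LeafRS`, Prop. 7 printed at `2α₂` — certified FALSE on the δ₂ carrier by dag-n05-w2's `not_prop7PrintedR_zdGF3HP₂_toAxialTower_halfspace`, p605631).  The RS class's
CONSEQUENCE family (`companionC`, guarded (0.20), END from nodes) reads only `w.C`, `w.γ`, `w.L`, `w.b`, `w.βup` and the C-companion — never the `b8` binding —, so it
ports VERBATIM to the `b8`-generic class; the HOSTING lemmas port with the binding displayed as `(upOfRecord₅C …).withB8 (b8sel P)`.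

WHAT IS DEFINED ∕ PROVED (kernel bookkeeping, 0 sorry): §1 `IsRecordOfRecord₁₃CSepCoPHG` (def), `…G_of_eq`, `exists_world_…G`, the two EMBEDDINGS
`isRecordOfRecord₁₃CSepCoPHG_of_isRecordOfRecord₁₃CSepCoPHS` (RS, via `upOfRecord₅CS_eq_withB8`) and `isRecordOfRecord₁₃CSepCoPHG_of_isRecordOfRecord₁₃CSepCoPH` (the
C-class itself, `b8sel := (upOfRecord₅C …).b8`, `rfl`), and the pointed SC form `isRecordOfRecord₁₃CSepCoPHG_of_eq_upSC` (`w.up P = upOfRecord₅CSC … C₇ P`, `rfl` on n05-w1's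
def); §2 CONSEQUENCES `exists_provisos_of_…G`, `construction_eq_of_…G`, `gamma_pos_of_…G`, `companionC_of_…G`, `rgFlow_of_smallCouplings_of_…G`, ★
`endStatementBPrinted_of_isRecordOfRecord₁₃CSepCoPHG_of_nodes`; §3 HOSTING `…G_rebindX_of_eq`, ★ `isRecordOfRecord₁₃CSepCoPHG_of_up_withB8_rebindX_view₁₃CoPHB10YZW` (the
four-pin view of a re-bound parameter, `X'` and `b8sel` FREE) with its RS ∕ SC instances `…_of_upS_rebindX_view₁₃CoPHB10YZW` ∕ `…_of_upSC_rebindX_view₁₃CoPHB10YZW`,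
`exists_worldG_…_rebindX_view_withB8`; §4 `rBasicStep_iff_of_up_withB8_rebindX_view₁₃CoPHB10YZW` (the N12 pin face, `b8`-generic).
HONEST FRAMING: one definition + kernel bookkeeping; NO estimate; nothing of Bałaban's asserted; whether a K1⁷ edition reads this class is the planners' word (v6 reads
`RecordS` = the RS class); N05 NOT discharged; K1 NOT claimed; counts unmoved; count-neutral; one finite T⁴ programme at fixed ε — NOT continuum ∕ ℝ⁴ ∕ OS ∕ mass gap ∕
Clay.  No `sorry`, no `axiom`, no `instance`, no `notation`.  Unit `pub-ymgap-dag-n05-w4` (g2), 2026-08-28.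
[Balaban1989LargeFieldII] = Commun. Math. Phys. **122** (1989) 355–392; [Balaban1988Convergent] = Commun. Math. Phys. **119** (1988) 243–285; [Balaban1987RG1] = Commun. Math. Phys.
**109** (1987) 249–301; [Balaban1985RegularSpaces] = Commun. Math. Phys. **99** (1985) 75–102.
-/

noncomputable section

namespace Literature.MathematicalPhysics.QuantumFieldTheory.Balaban1983to89.Node00

open T4Continuum AveragingRT T4FiniteEpsInhabited FlowStep FlowStepRuns DagBinding T4DatumAssembly
open scoped Matrix.Norms.L2Operator

/-! ## §1. The `b8`-generic S-class; pointed forms; the RS, C and SC embeddings -/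

section GClass

variable (F : T4Family) (N : ℕ) [NeZero N]

/-- **«(D, w) is the record, Stage 13, v1.7, C-binding with the `b8` block RE-BOUND to `b8sel P`»** — def-T's `IsRecordOfRecord₁₃CSepCoPH` VERBATIM with the world bound,
run by run, to `(upOfRecord₅C (θ.toStage5₁₃CoPH) P).withB8 (b8sel P)` for SOME run-indexed proposition `b8sel` (the [B8] leaf in whatever currency the presenting lane
reads: RS `B8LeafRS` — dag-n10-d's `IsRecordOfRecord₁₃CSepCoPHS` —, repaired `B8LeafRSC … C₇` — dag-n05-w1's `upOfRecord₅CSC` —, or the typed `B8LeafR`).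
[cite: Balaban1989LargeFieldII, Thm 1 + (0.1) pp.355–356; Balaban1988Convergent, (0.2) p.244, (2.17)–(2.18) p.257, Thms 1–2 pp.262–263; Balaban1985RegularSpaces, Thm 8 p.101 (the `b8` block; objects of record, bookkeeping)] -/
def IsRecordOfRecord₁₃CSepCoPHG (D : FiniteEpsData F (SU N)) (w : WorldP) : Prop :=
  ∃ (θ : Stage13HParams F N) (h : θ.Provisos₁₃SepCoPH F N) (b8sel : B12.RunParams → Prop), θ.Admissible F N ∧ D = datumOfRecord₁₃SepCoPH F N θ h ∧ w.C = D.C ∧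
    (0 < w.γ ∧ w.γ ≤ θ.γ) ∧ w.L = (θ.L : ℝ) ∧ ∀ P : B12.RunParams, w.up P = (upOfRecord₅C F N (θ.toStage5₁₃CoPH F N) P).withB8 (b8sel P)

/-- **Pointed form** (presenting parameter `θ` itself, any `b8sel`). [cite: Balaban1989LargeFieldII, Thm 1 + (0.1) pp.355–356 (bookkeeping)] -/
theorem isRecordOfRecord₁₃CSepCoPHG_of_eq (θ : Stage13HParams F N) (h : θ.Provisos₁₃SepCoPH F N) (hθ : θ.Admissible F N) (b8sel : B12.RunParams → Prop) (w : WorldP)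
    (hC : w.C = (datumOfRecord₁₃SepCoPH F N θ h).C) (hγ : 0 < w.γ ∧ w.γ ≤ θ.γ) (hL : w.L = (θ.L : ℝ))
    (hup : ∀ P, w.up P = (upOfRecord₅C F N (θ.toStage5₁₃CoPH F N) P).withB8 (b8sel P)) :
    IsRecordOfRecord₁₃CSepCoPHG F N (datumOfRecord₁₃SepCoPH F N θ h) w :=
  ⟨θ, h, b8sel, hθ, rfl, hC, hγ, hL, hup⟩

/-- **Every admissible v1.7 parameter with the v1.7 provisos presents a G-class record of its own datum**, any `b8sel`, any window `0 < γw ≤ θ.γ`.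
[cite: Balaban1989LargeFieldII, Thm 1 + (0.1) pp.355–356 (bookkeeping)] -/
theorem exists_world_isRecordOfRecord₁₃CSepCoPHG (θ : Stage13HParams F N) (h : θ.Provisos₁₃SepCoPH F N) (hθ : θ.Admissible F N) (b8sel : B12.RunParams → Prop)
    {γw : ℝ} (hγw : 0 < γw ∧ γw ≤ θ.γ) :
    ∃ w : WorldP, IsRecordOfRecord₁₃CSepCoPHG F N (datumOfRecord₁₃SepCoPH F N θ h) w ∧ w.γ = γw ∧ w.L = (θ.L : ℝ) ∧
      ∀ P, w.up P = (upOfRecord₅C F N (θ.toStage5₁₃CoPH F N) P).withB8 (b8sel P) := by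
  obtain ⟨w₀⟩ := nonempty_worldP
  exact ⟨{ w₀ with
      C := (datumOfRecord₁₃SepCoPH F N θ h).C, γ := γw, L := (θ.L : ℝ), one_lt_L := by exact_mod_cast θ.hL.2,
      up := fun P => (upOfRecord₅C F N (θ.toStage5₁₃CoPH F N) P).withB8 (b8sel P) },
    ⟨θ, h, b8sel, hθ, rfl, rfl, hγw, rfl, fun _ => rfl⟩, rfl, rfl, fun _ => rfl⟩

variable {F N}
variable {D : FiniteEpsData F (SU N)} {w : WorldP}

/-- **THE RS CLASS IS INSIDE** (`upOfRecord₅CS = (upOfRecord₅C …).withB8 (its own `b8`)`, dag-n10-d's ∕ node00-def's `upOfRecord₅CS_eq_withB8`, `rfl`): every record of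
dag-n10-d's `IsRecordOfRecord₁₃CSepCoPHS` is a G-class record with `b8sel P := (upOfRecord₅CS … P).b8` (the RS leaf `B8LeafRS`).
[cite: Balaban1985RegularSpaces, Thm 8 p.101 (surviving form); Balaban1989LargeFieldII, Thm 1 + (0.1) pp.355–356 (bookkeeping)] -/
theorem isRecordOfRecord₁₃CSepCoPHG_of_isRecordOfRecord₁₃CSepCoPHS (h : IsRecordOfRecord₁₃CSepCoPHS F N D w) : IsRecordOfRecord₁₃CSepCoPHG F N D w := by
  obtain ⟨θ, hP, hθ, hD, hC, hγ, hL, hup⟩ := h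
  exact ⟨θ, hP, fun P => (upOfRecord₅CS F N (θ.toStage5₁₃CoPH F N) P).b8, hθ, hD, hC, hγ, hL, fun P => by
    rw [hup P]; exact upOfRecord₅CS_eq_withB8 F N _ P⟩

/-- **THE C-CLASS IS INSIDE** (`u.withB8 u.b8 = u`, structure eta, `rfl`): every def-T `IsRecordOfRecord₁₃CSepCoPH` record is a G-class record with `b8sel P := (upOfRecord₅C … P).b8`
(the TYPED leaf). [cite: Balaban1989LargeFieldII, Thm 1 + (0.1) pp.355–356 (bookkeeping)] -/
theorem isRecordOfRecord₁₃CSepCoPHG_of_isRecordOfRecord₁₃CSepCoPH (h : IsRecordOfRecord₁₃CSepCoPH F N D w) : IsRecordOfRecord₁₃CSepCoPHG F N D w := by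
  obtain ⟨θ, hP, hθ, hD, hC, hγ, hL, hup⟩ := h
  exact ⟨θ, hP, fun P => (upOfRecord₅C F N (θ.toStage5₁₃CoPH F N) P).b8, hθ, hD, hC, hγ, hL, fun P => by rw [hup P]; rfl⟩

variable (F N) in
/-- **Pointed SC form** (dag-n05-w1's repaired-currency binding `upOfRecord₅CSC … C₇ = (upOfRecord₅C …).withB8 (B8LeafRSC … C₇ …)`, `rfl` on its definition): a world bound to
`upOfRecord₅CSC (θ.toStage5₁₃CoPH) C₇` at the presenting parameter is a G-class record, any `C₇`. [cite: Balaban1985RegularSpaces, Prop. 7 p.100, Thm 8 p.101 (repaired currency); Balaban1989LargeFieldII, Thm 1 + (0.1) pp.355–356 (bookkeeping)] -/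
theorem isRecordOfRecord₁₃CSepCoPHG_of_eq_upSC (θ : Stage13HParams F N) (h : θ.Provisos₁₃SepCoPH F N) (hθ : θ.Admissible F N) (C₇ : ℝ) (w : WorldP)
    (hC : w.C = (datumOfRecord₁₃SepCoPH F N θ h).C) (hγ : 0 < w.γ ∧ w.γ ≤ θ.γ) (hL : w.L = (θ.L : ℝ))
    (hup : ∀ P, w.up P = upOfRecord₅CSC F N (θ.toStage5₁₃CoPH F N) C₇ P) :
    IsRecordOfRecord₁₃CSepCoPHG F N (datumOfRecord₁₃SepCoPH F N θ h) w :=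
  ⟨θ, h, fun P => (upOfRecord₅CSC F N (θ.toStage5₁₃CoPH F N) C₇ P).b8, hθ, rfl, hC, hγ, hL, fun P => by rw [hup P]; rfl⟩

end GClass

/-! ## §2. CONSEQUENCES of a G-class record: provisos, construction, window, the same-constants C-COMPANION, the guarded (0.20) leaf, END FROM NODES (verbatim ports — none reads `b8`) -/

section Consequences

variable {F : T4Family} {N : ℕ} [NeZero N]
variable {D : FiniteEpsData F (SU N)} {w : WorldP}

/-- A G-class record CERTIFIES its parameters' provisos, admissibility and datum. [cite: Balaban1989LargeFieldI, (0.3)–(0.4) p.176 (bookkeeping)] -/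
theorem exists_provisos_of_isRecordOfRecord₁₃CSepCoPHG (h : IsRecordOfRecord₁₃CSepCoPHG F N D w) :
    ∃ (θ : Stage13HParams F N) (hP : θ.Provisos₁₃SepCoPH F N), θ.Admissible F N ∧ D = datumOfRecord₁₃SepCoPH F N θ hP := by
  obtain ⟨θ, hP, -, hθ, hD, -⟩ := h
  exact ⟨θ, hP, hθ, hD⟩

/-- The world is bound to the datum's construction. [cite: Balaban1989LargeFieldII, Thm 1 + (0.1) pp.355–356 (bookkeeping)] -/
theorem construction_eq_of_isRecordOfRecord₁₃CSepCoPHG (h : IsRecordOfRecord₁₃CSepCoPHG F N D w) : w.C = D.C := by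
  obtain ⟨θ, hP, -, -, -, hC, -⟩ := h
  exact hC

/-- The world's window is non-degenerate. [cite: Balaban1987RG1, (0.20) p.256 (bookkeeping)] -/
theorem gamma_pos_of_isRecordOfRecord₁₃CSepCoPHG (h : IsRecordOfRecord₁₃CSepCoPHG F N D w) : 0 < w.γ := by
  obtain ⟨θ, hP, -, -, -, -, hγ, -⟩ := h
  exact hγ.1

/-- **THE SAME-CONSTANTS C-COMPANION**: re-binding the world's upstream blocks to the C-BINDING at the presenting parameter (every other constant kept) gives a def-T
`IsRecordOfRecord₁₃CSepCoPH` record AT THE SAME DATUM; leaves agree off `b8` (`leavesP_eq_of_up_withB8`).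
[cite: Balaban1989LargeFieldII, Thm 1 + (0.1) pp.355–356; Balaban1985RegularSpaces, Thm 8 p.101 (bookkeeping)] -/
theorem companionC_of_isRecordOfRecord₁₃CSepCoPHG (h : IsRecordOfRecord₁₃CSepCoPHG F N D w) :
    ∃ w' : WorldP, IsRecordOfRecord₁₃CSepCoPH F N D w' ∧ w'.C = w.C ∧ w'.γ = w.γ ∧ w'.L = w.L ∧ w'.b = w.b ∧ w'.βup = w.βup ∧
      ∀ P : B12.RunParams, leavesP w P = { leavesP w' P with b8 := (leavesP w P).b8 } := by
  obtain ⟨θ, hP, b8sel, hθ, hD, hC, hγ, hL, hup⟩ := h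
  have hup' : ∀ P, w.up P = (upOfRecord₅C F N (θ.toStage5₁₃CoPH F N) P).withB8 (leavesP w P).b8 := fun P => by
    show w.up P = (upOfRecord₅C F N _ P).withB8 (w.up P).b8
    rw [hup P]
    rfl
  exact ⟨{ w with up := fun P => upOfRecord₅C F N (θ.toStage5₁₃CoPH F N) P }, ⟨θ, hP, hθ, hD, hC, hγ, hL, fun _ => rfl⟩, rfl, rfl, rfl, rfl, rfl,
    leavesP_eq_of_up_withB8 hup'⟩

/-- **GUARDED (0.20) AT EVERY G-CLASS RECORD**: the leaf reads `w.C`, `w.γ` only — def-T's C-class instance at the C-companion, verbatim. [cite: Balaban1987RG1, (0.20) p.256] -/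
theorem rgFlow_of_smallCouplings_of_isRecordOfRecord₁₃CSepCoPHG (h : IsRecordOfRecord₁₃CSepCoPHG F N D w) (P : B12.RunParams)
    (hsc : (leavesP w P).smallCouplings) : (leavesP w P).rgFlow := by
  obtain ⟨θ, hP, b8sel, hθ, hD, hC, hγ, hL, hup⟩ := h
  have hR' : IsRecordOfRecord₁₃CSepCoPH F N D { w with up := fun P => upOfRecord₅C F N (θ.toStage5₁₃CoPH F N) P } :=
    ⟨θ, hP, hθ, hD, hC, hγ, hL, fun _ => rfl⟩
  exact rgFlow_of_smallCouplings_of_isRecordOfRecord₁₃CSepCoPH hR' P hsc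

/-- ★ **END FROM NODES AT ANY G-CLASS RECORD**: the DAG's nodes at every run and the β bounds in a window `γ₀ ≥ w.γ` give print's END STATEMENT for `D.C` (node00-def's
`endStatementBPrinted_of_nodesP_interval_guarded` with the guarded (0.20) leaf above) — whatever currency the `b8` leaf is read in.
[cite: Balaban1989LargeFieldII, Thm 1 + (0.1) pp.355–356; Balaban1987RG1, (0.20) p.256; Balaban1988Convergent, Thms 1–2 pp.262–263 (bookkeeping)] -/
theorem endStatementBPrinted_of_isRecordOfRecord₁₃CSepCoPHG_of_nodes (h : IsRecordOfRecord₁₃CSepCoPHG F N D w) {γ₀ : ℝ} (hγ₀ : w.γ ≤ γ₀)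
    (hnodes : ∀ P, Nodes (leavesP w P)) (hβ : BetaBoundsInInterval w.C.toB12 γ₀ w.b w.βup) :
    B16.EndStatementBPrinted D.C := by
  rw [← construction_eq_of_isRecordOfRecord₁₃CSepCoPHG h]
  exact endStatementBPrinted_of_nodesP_interval_guarded w (gamma_pos_of_isRecordOfRecord₁₃CSepCoPHG h) hγ₀ hnodes
    (rgFlow_of_smallCouplings_of_isRecordOfRecord₁₃CSepCoPHG h) hβ

end Consequences

/-! ## §3. HOSTING: worlds bound by `withB8` over re-bound views and over the four-pin view of a re-bound parameter are in the G-class AT θ's OWN DATUM -/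

section Hosting

variable (F : T4Family) (N : ℕ) [NeZero N]

/-- **A world bound by `(upOfRecord₅C ((θ.rebindX X').toStage5₁₃CoPH) P).withB8 (b8sel P)` is a G-class record at θ's own datum** (presenting parameter `θ.rebindX X'`;
provisos `Provisos₁₃SepCoPH.rebindX`, admissibility `Iff.rfl`, datum UP-SIDE `datumOfRecord₁₃SepCoPH_rebindX`). [cite: Balaban1989LargeFieldII, Thm 1 + (0.1) pp.355–356 (bookkeeping)] -/
theorem isRecordOfRecord₁₃CSepCoPHG_rebindX_of_eq (θ : Stage13HParams F N) (h : θ.Provisos₁₃SepCoPH F N) (hθ : θ.Admissible F N) (X' : B12.RunParams → PrintedCarriersR)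
    (b8sel : B12.RunParams → Prop) (w : WorldP) (hC : w.C = (datumOfRecord₁₃SepCoPH F N θ h).C) (hγ : 0 < w.γ ∧ w.γ ≤ θ.γ) (hL : w.L = (θ.L : ℝ))
    (hup : ∀ P, w.up P = (upOfRecord₅C F N ((θ.rebindX F N X').toStage5₁₃CoPH F N) P).withB8 (b8sel P)) :
    IsRecordOfRecord₁₃CSepCoPHG F N (datumOfRecord₁₃SepCoPH F N θ h) w :=
  ⟨θ.rebindX F N X', h.rebindX X', b8sel, (Stage13HParams.rebindX_admissible_iff F N θ X').2 hθ,
    (datumOfRecord₁₃SepCoPH_rebindX F N θ h X' (h.rebindX X')).symm, hC, hγ, hL, hup⟩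

/-- ★ **HOSTING AT THE FOUR-PIN VIEW OF A RE-BOUND PARAMETER, `b8` GENERIC** (`X'` and `b8sel` FREE — dag-n24-c's engine world on any carrier with any `b8` currency): a world with
`w.C = (datumOfRecord₁₃SepCoPH θ h).C`, `0 < w.γ ≤ θ.γ`, `w.L = θ.L`, `w.up P = (upOfRecord₅C ((θ.rebindX X').view₁₃CoPHB10YZW M⋆ ops ζ λW) P).withB8 (b8sel P)` IS in the G-class AT θ's DATUM —
presenting parameter the quintuply pinned `((((θ.rebindX X').pinB10).pinY …).pinZ …).pinW …` exactly as in dag-n10-d's RS proof (`isRecordOfRecord₁₃CSepCoPHS_of_upS_rebindX_view₁₃CoPHB10YZW`).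
[cite: Balaban1989LargeFieldII, Thm 1 + (0.1) pp.355–356; Balaban1985UV3, Thm 1 p.257; Balaban1985BackgroundPropagators, Thm 3.1 p.397; Balaban1985Variational, Thm 1 p.279; Balaban1989LargeFieldI, (0.2) p.176 (objects of record; bookkeeping)] -/
theorem isRecordOfRecord₁₃CSepCoPHG_of_up_withB8_rebindX_view₁₃CoPHB10YZW (θ : Stage13HParams F N) (hP : θ.Provisos₁₃SepCoPH F N) (hθ : θ.Admissible F N)
    (X' : B12.RunParams → PrintedCarriersR) (Mstar : ℕ) (ops : OpsY N θ.toStage3Params Mstar) (ζ : ResidZ F N) (lamW : ResidW F N) (b8sel : B12.RunParams → Prop) (w : WorldP)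
    (hC : w.C = (datumOfRecord₁₃SepCoPH F N θ hP).C) (hγ : 0 < w.γ ∧ w.γ ≤ θ.γ) (hL : w.L = (θ.L : ℝ))
    (hup : ∀ P, w.up P = (upOfRecord₅C F N ((θ.rebindX F N X').view₁₃CoPHB10YZW F N Mstar ops ζ lamW) P).withB8 (b8sel P)) :
    IsRecordOfRecord₁₃CSepCoPHG F N (datumOfRecord₁₃SepCoPH F N θ hP) w := by
  have hX : (θ.rebindX F N X').Provisos₁₃SepCoPH F N := hP.rebindX X'
  have hD := datumOfRecord₁₃SepCoPH_rebindX F N θ hP X' hX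
  rw [← hD] at hC ⊢
  set θX := θ.rebindX F N X' with hθX
  have hθ' : θX.Admissible F N := (Stage13HParams.rebindX_admissible_iff F N θ X').2 hθ
  have hA1 : (θX.pinB10 F N).Admissible F N := (Stage13Params.pinB10_admissible_iff F N θX.toStage13Params).2 hθ'
  have hA2 : ((θX.pinB10 F N).pinY F N (Y9OfRecord N θX.toStage3Params Mstar ops)).Admissible F N :=
    (Stage13Params.pinY_admissible_iff F N (θX.pinB10 F N).toStage13Params (Y9OfRecord N θX.toStage3Params Mstar ops)).2 hA1
  have hA3 : (((θX.pinB10 F N).pinY F N (Y9OfRecord N θX.toStage3Params Mstar ops)).pinZ F N (Z11OfRecord F N ζ)).Admissible F N :=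
    (Stage13Params.pinZ_admissible_iff F N ((θX.pinB10 F N).pinY F N (Y9OfRecord N θX.toStage3Params Mstar ops)).toStage13Params (Z11OfRecord F N ζ)).2 hA2
  have hA4 : ((((θX.pinB10 F N).pinY F N (Y9OfRecord N θX.toStage3Params Mstar ops)).pinZ F N (Z11OfRecord F N ζ)).pinW F N
      (WOfRecord₁₃ F N θX.toStage13Params lamW)).Admissible F N :=
    (Stage13Params.pinW_admissible_iff F N (((θX.pinB10 F N).pinY F N (Y9OfRecord N θX.toStage3Params Mstar ops)).pinZ F N (Z11OfRecord F N ζ)).toStage13Params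
      (WOfRecord₁₃ F N θX.toStage13Params lamW)).2 hA3
  refine ⟨(((θX.pinB10 F N).pinY F N (Y9OfRecord N θX.toStage3Params Mstar ops)).pinZ F N (Z11OfRecord F N ζ)).pinW F N (WOfRecord₁₃ F N θX.toStage13Params lamW),
    ((hX.pinB10.pinY (Y9OfRecord N θX.toStage3Params Mstar ops)).pinZ (Z11OfRecord F N ζ)).pinW (WOfRecord₁₃ F N θX.toStage13Params lamW), b8sel, hA4, ?_, hC, hγ, hL,
    fun P => ?_⟩
  · exact ((datumOfRecord₁₃SepCoPH_pinB10 F N θX hX).symm.trans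
      ((datumOfRecord₁₃SepCoPH_pinY F N (θX.pinB10 F N) hX.pinB10 (Y9OfRecord N θX.toStage3Params Mstar ops)).symm.trans
        ((datumOfRecord₁₃SepCoPH_pinZ F N _ (hX.pinB10.pinY (Y9OfRecord N θX.toStage3Params Mstar ops)) (Z11OfRecord F N ζ)).symm.trans
          (datumOfRecord₁₃SepCoPH_pinW F N _ ((hX.pinB10.pinY (Y9OfRecord N θX.toStage3Params Mstar ops)).pinZ (Z11OfRecord F N ζ))
            (WOfRecord₁₃ F N θX.toStage13Params lamW)).symm)))
  · rw [hup P, Stage13HParams.view₁₃CoPHB10YZW_eq]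

/-- The RS instance (`upOfRecord₅CS = withB8 (its RS leaf)`): dag-n10-d's four-pin hosting re-read in the G-class. [cite: Balaban1989LargeFieldII, Thm 1 + (0.1) pp.355–356 (bookkeeping)] -/
theorem isRecordOfRecord₁₃CSepCoPHG_of_upS_rebindX_view₁₃CoPHB10YZW (θ : Stage13HParams F N) (hP : θ.Provisos₁₃SepCoPH F N) (hθ : θ.Admissible F N)
    (X' : B12.RunParams → PrintedCarriersR) (Mstar : ℕ) (ops : OpsY N θ.toStage3Params Mstar) (ζ : ResidZ F N) (lamW : ResidW F N) (w : WorldP)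
    (hC : w.C = (datumOfRecord₁₃SepCoPH F N θ hP).C) (hγ : 0 < w.γ ∧ w.γ ≤ θ.γ) (hL : w.L = (θ.L : ℝ))
    (hup : ∀ P, w.up P = upOfRecord₅CS F N ((θ.rebindX F N X').view₁₃CoPHB10YZW F N Mstar ops ζ lamW) P) :
    IsRecordOfRecord₁₃CSepCoPHG F N (datumOfRecord₁₃SepCoPH F N θ hP) w :=
  isRecordOfRecord₁₃CSepCoPHG_of_up_withB8_rebindX_view₁₃CoPHB10YZW F N θ hP hθ X' Mstar ops ζ lamW
    (fun P => (upOfRecord₅CS F N ((θ.rebindX F N X').view₁₃CoPHB10YZW F N Mstar ops ζ lamW) P).b8) w hC hγ hL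
    (fun P => by rw [hup P]; exact upOfRecord₅CS_eq_withB8 F N _ P)

/-- ★ **The SC instance** (dag-n05-w1's repaired-currency binding `upOfRecord₅CSC … C₇ = withB8 (B8LeafRSC … C₇ …)`, `rfl`): a world S-bound IN THE REPAIRED CURRENCY over the
four-pin view of a re-bound parameter is a G-class record at θ's datum — the membership the «P₂C» X-view records and an SC-keyed four-pin engine need.
[cite: Balaban1985RegularSpaces, Prop. 7 p.100, Thm 8 p.101 (repaired currency); Balaban1989LargeFieldII, Thm 1 + (0.1) pp.355–356 (bookkeeping)] -/
theorem isRecordOfRecord₁₃CSepCoPHG_of_upSC_rebindX_view₁₃CoPHB10YZW (θ : Stage13HParams F N) (hP : θ.Provisos₁₃SepCoPH F N) (hθ : θ.Admissible F N)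
    (X' : B12.RunParams → PrintedCarriersR) (Mstar : ℕ) (ops : OpsY N θ.toStage3Params Mstar) (ζ : ResidZ F N) (lamW : ResidW F N) (C₇ : ℝ) (w : WorldP)
    (hC : w.C = (datumOfRecord₁₃SepCoPH F N θ hP).C) (hγ : 0 < w.γ ∧ w.γ ≤ θ.γ) (hL : w.L = (θ.L : ℝ))
    (hup : ∀ P, w.up P = upOfRecord₅CSC F N ((θ.rebindX F N X').view₁₃CoPHB10YZW F N Mstar ops ζ lamW) C₇ P) :
    IsRecordOfRecord₁₃CSepCoPHG F N (datumOfRecord₁₃SepCoPH F N θ hP) w :=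
  isRecordOfRecord₁₃CSepCoPHG_of_up_withB8_rebindX_view₁₃CoPHB10YZW F N θ hP hθ X' Mstar ops ζ lamW
    (fun P => (upOfRecord₅CSC F N ((θ.rebindX F N X').view₁₃CoPHB10YZW F N Mstar ops ζ lamW) C₇ P).b8) w hC hγ hL
    (fun P => by rw [hup P]; rfl)

/-- **… and such worlds EXIST** at every admissible v1.7 parameter with the v1.7 provisos, any pins, any `b8sel`, any window `0 < γw ≤ θ.γ`. [cite: Balaban1989LargeFieldII, Thm 1 + (0.1) pp.355–356 (bookkeeping)] -/
theorem exists_worldG_isRecordOfRecord₁₃CSepCoPHG_rebindX_view_withB8 (θ : Stage13HParams F N) (hP : θ.Provisos₁₃SepCoPH F N) (hθ : θ.Admissible F N)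
    (X' : B12.RunParams → PrintedCarriersR) (Mstar : ℕ) (ops : OpsY N θ.toStage3Params Mstar) (ζ : ResidZ F N) (lamW : ResidW F N) (b8sel : B12.RunParams → Prop)
    {γw : ℝ} (hγw : 0 < γw ∧ γw ≤ θ.γ) :
    ∃ w : WorldP, IsRecordOfRecord₁₃CSepCoPHG F N (datumOfRecord₁₃SepCoPH F N θ hP) w ∧ w.γ = γw ∧ w.L = (θ.L : ℝ) ∧
      ∀ P, w.up P = (upOfRecord₅C F N ((θ.rebindX F N X').view₁₃CoPHB10YZW F N Mstar ops ζ lamW) P).withB8 (b8sel P) := by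
  obtain ⟨w₀⟩ := nonempty_worldP
  let w : WorldP :=
    { w₀ with
      C := (datumOfRecord₁₃SepCoPH F N θ hP).C, γ := γw, L := (θ.L : ℝ), one_lt_L := by exact_mod_cast θ.hL.2,
      up := fun P => (upOfRecord₅C F N ((θ.rebindX F N X').view₁₃CoPHB10YZW F N Mstar ops ζ lamW) P).withB8 (b8sel P) }
  exact ⟨w, isRecordOfRecord₁₃CSepCoPHG_of_up_withB8_rebindX_view₁₃CoPHB10YZW F N θ hP hθ X' Mstar ops ζ lamW b8sel w rfl hγw rfl (fun _ => rfl), rfl, rfl,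
    fun _ => rfl⟩

end Hosting

/-! ## §4. The N12 pin face at a world bound by `withB8` over the four-pin view of a re-bound parameter -/

section PinFaces

variable {F : T4Family} {N : ℕ} [NeZero N]

/-- **On every run the `rBasicStep` leaf the DAG reads IS `B15Leaf` at NODE 00's bundle of record `WOfRecord₁₃ θ λW P`**, whatever the `b8` binding (`withB8` does not touch
`rBasicStep`; dag-n10-d's `upOfRecord₅C_view₁₃CoPHB10YZW_leaves`, first conjunct). [cite: Balaban1989LargeFieldI, Prop. 1 p.194, (0.2) p.176 (bookkeeping)] -/
theorem rBasicStep_iff_of_up_withB8_rebindX_view₁₃CoPHB10YZW (θ : Stage13HParams F N) (X' : B12.RunParams → PrintedCarriersR) (Mstar : ℕ)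
    (ops : OpsY N θ.toStage3Params Mstar) (ζ : ResidZ F N) (lamW : ResidW F N) (b8sel : B12.RunParams → Prop) (w : WorldP)
    (hup : ∀ P, w.up P = (upOfRecord₅C F N ((θ.rebindX F N X').view₁₃CoPHB10YZW F N Mstar ops ζ lamW) P).withB8 (b8sel P)) (P : B12.RunParams) :
    (leavesP w P).rBasicStep ↔ B15Leaf (WOfRecord₁₃ F N θ.toStage13Params lamW P) := by
  have hW : WOfRecord₁₃ F N (θ.rebindX F N X').toStage13Params lamW = WOfRecord₁₃ F N θ.toStage13Params lamW := rfl
  rw [← hW]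
  show (w.up P).rBasicStep ↔ _
  rw [hup P]
  exact (upOfRecord₅C_view₁₃CoPHB10YZW_leaves F N (θ.rebindX F N X') Mstar ops ζ lamW P).1

end PinFaces

end Literature.MathematicalPhysics.QuantumFieldTheory.Balaban1983to89.Node00

end
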